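import Literature.AnabelianGeometry.EtaleTheta.TemperedCoverings

/-!
# [EtTh] Def 3.1 / Prop 3.2: the interface `LogDivisorModel` is inhabited (consistency witness)

S. Mochizuki, *The étale theta function …*, Publ. RIMS **45** (2009) [MochizukiEtTh2009], §3, Definition
3.1 and Proposition 3.2, PDF p.70 (printed p.296).  The statement file `TemperedCoverings.lean`
(abc-iut-L2-t3) types the universal combinatorial covering `Z^log_∞` as the INTERFACE
`LogDivisorModel` (log-divisors, log-meromorphic functions, the three assertions of Prop 3.2 as fields).
Reviewer's advisory on p410002 (2026-08-25): "`LogDivisorModel` still has no inhabitant anywhere in the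
tree … file a witness item (`LogDivisorModel.toy`) so the interface is not vacuous by accident."

This file (owner, gen 2) builds that witness: the DEGENERATE model with trivial function group, trivial
divisor group and no cusps / no special-fibre components (the "empty curve").  It certifies only that the
twenty-odd fields of `LogDivisorModel` are jointly satisfiable (in particular the v3 form `divPlusEquiv` of
Def 3.1 (i) — the v2 field it replaced was unsatisfiable for infinite index sets); it is NOT a model of an
actual tempered covering.  HONEST FRAMING: a consistency check of a typed interface; nothing here bears on
[IUTchIII] Cor. 3.12.
-/

namespace Literature.AnabelianGeometry.EtaleTheta

namespace LogDivisorModel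

/-- **The trivial `LogDivisorModel`**: `Fn = DIV = 1`, `Cusp = Comp = ∅`; every field of the interface of
Def 3.1 / Prop 3.2 holds trivially.  A consistency (non-vacuity) witness for the interface, no more.
[cite: MochizukiEtTh2009, Def 3.1 p.70] -/
def toy : LogDivisorModel.{0} where
  Fn := PUnit
  DIV := PUnit
  DIVplus := ⊤
  Div := ⊤
  exists_div_eq _ := ⟨1, trivial, 1, trivial, Subsingleton.elim _ _⟩
  eq_one_of_mem_of_inv_mem _ _ _ := Subsingleton.elim _ _
  nonCuspidal := ⊤
  cuspidal := ⊥
  nonCuspidal_isCompl_cuspidal := isCompl_top_bot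
  logMero := ⊤
  divisor := 1
  divisor_mem_Div _ := trivial
  const := ⊤
  const_le_logMero := le_rfl
  intConst := ⊤
  intConst_le_const := le_rfl
  temperedMero := ⊤
  temperedMero_le_logMero := le_rfl
  exists_pow_mem_Div := ⟨1, fun _ => trivial⟩
  Cusp := PEmpty
  Comp := PEmpty
  divPlusEquiv :=
    { toFun := fun _ _ => 1
      invFun := fun _ => ⟨PUnit.unit, trivial⟩
      left_inv := fun _ => Subsingleton.elim _ _
      right_inv := fun _ => Subsingleton.elim _ _
      map_mul' := fun _ _ => Subsingleton.elim _ _ }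
  divPlusEquiv_nonCuspidal _ := ⟨fun _ c => c.elim, fun _ => trivial⟩
  mem_intConst_of_divisor_mem _ _ := trivial
  divisor_mem_of_mem_intConst _ _ := ⟨trivial, trivial⟩
  divisor_eq_one_iff _ := ⟨fun _ => ⟨trivial, trivial⟩, fun _ => Subsingleton.elim _ _⟩
  eq_one_of_forall_exists_pow_eq _ _ := Subsingleton.elim _ _

/-- The interface `LogDivisorModel` is inhabited. [cite: MochizukiEtTh2009, Def 3.1 p.70] -/
theorem nonempty : Nonempty LogDivisorModel.{0} := ⟨toy⟩

end LogDivisorModel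

end Literature.AnabelianGeometry.EtaleTheta
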